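import Literature.NumberTheory.LFunctions.ClassGroupExplicitFormula
import Literature.NumberTheory.LFunctions.UniformClassGroupPNTGeneralDegreeInputs
import Literature.NumberTheory.LFunctions.DedekindZeta1LogFreeTheorem14
import HarnessLib

/-!
# The log-free zero-density hypothesis, restricted to ONE character, in `Q`-form

Topic `Summits/QuantumAdvantage/QuantumAdvantage/Theorems`, helper for the stub
`stub_perCharacterDeficit_of_density` (line `subgroup-orthogonality-escape`, crux
`DegreeOnePrimesEscape`, stmt-QuantumAdvantage-11543).

The stub's hypothesis is the log-free zero-density estimate for the family `{L₀(s,χ)}_{χ ≠ 1}` of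
class group `L`-functions of a number field of degree `n`, in the shape of the tree's
`logFreeDensity_classGroup`: a size parameter `P ≥ 2` dominating `|d_K|`, `h_K`, `κ_K⁻¹` and the
heights, and `Σ_{ψ ≠ 0} Σ_{ρ ∈ Z(χ_ψ), β ≥ α} m(ρ) ≤ C_D P^{c_D(1−α)}`. Here we restrict it to ONE
character `χ ≠ 1` (all terms are `≥ 0`) and put `P = Q^a (T + 2)`, `Q = condQn K = |d_K| n^n`,
`a = max A 4`, for fields with `κ_K ≥ Q^{−A}` (`|d_K| ≤ Q`, `h_K ≤ Q⁴`, `classNumber_le_condQn_pow`):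
`Σ_{ρ ∈ u, β ≥ α} m(ρ) ≤ C_D e^{c_D (a log Q + log(T + 4))(1−α)}` for every finite set `u` of zeros of
`L₀(·,χ)` with `1/4 ≤ β < 1`, `|γ| ≤ T` (`T ≥ 1`, `α ≤ 1`) — the shape consumed by
`LinnikZeroSum.sum_rpow_div_le_of_density_zfr` (`density_oneChar`).
-/

noncomputable section

open Complex Real
open scoped NumberField nonZeroDivisors
open Literature.NumberTheory.LFunctions Literature.NumberTheory.LFunctions.NumberField
  Literature.NumberTheory.LFunctions.AbelianDensity Literature.NumberTheory.LFunctions.LogFreeLocal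

namespace Summit.QuantumAdvantage.QuantumAdvantage.Theorems.DegreeOnePrimesEscape

/-- The size parameter `P = Q^a (T + 2)` is admissible: `P ≥ 2`, `|d_K| ≤ P`, `h_K ≤ P`,
`P⁻¹ ≤ κ_K`, `T ≤ P`, for `a ≥ max A 4`, `κ_K ≥ Q^{−A}`, `T ≥ 1`, `n_K > 1`. -/
theorem sizeParam_admissible (K : Type) [Field K] [NumberField K] (hK : 1 < Module.finrank ℚ K)
    {A a T : ℝ} (haA : A ≤ a) (ha4 : 4 ≤ a) (hT : 1 ≤ T)
    (hκ : ThornerZaman.condQn K ^ (-A) ≤ NumberField.dedekindZeta_residue K) :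
    2 ≤ ThornerZaman.condQn K ^ a * (T + 2) ∧
      ((NumberField.discr K).natAbs : ℝ) ≤ ThornerZaman.condQn K ^ a * (T + 2) ∧
      (Fintype.card (ClassGroup (𝓞 K)) : ℝ) ≤ ThornerZaman.condQn K ^ a * (T + 2) ∧
      (ThornerZaman.condQn K ^ a * (T + 2))⁻¹ ≤ NumberField.dedekindZeta_residue K ∧
      T ≤ ThornerZaman.condQn K ^ a * (T + 2) := by
  set Q : ℝ := ThornerZaman.condQn K with hQ
  have hQ12 : (12 : ℝ) ≤ Q := ThornerZaman.twelve_le_condQn (K := K) hK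
  have hQ1 : (1 : ℝ) ≤ Q := by linarith
  have hQa1 : (1 : ℝ) ≤ Q ^ a := Real.one_le_rpow hQ1 (by linarith)
  have hQaQ : Q ≤ Q ^ a := by
    have : Q ^ (1 : ℝ) ≤ Q ^ a := Real.rpow_le_rpow_of_exponent_le hQ1 (by linarith)
    rwa [Real.rpow_one] at this
  have hP_ge : Q ^ a ≤ Q ^ a * (T + 2) := by nlinarith
  have hd : ((NumberField.discr K).natAbs : ℝ) ≤ Q := by
    rw [hQ, ThornerZaman.condQn, Nat.cast_natAbs, Int.cast_abs]
    have hn1 : (1 : ℝ) ≤ (Module.finrank ℚ K : ℝ) ^ Module.finrank ℚ K := by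
      have : (1 : ℝ) ≤ Module.finrank ℚ K := by
        exact_mod_cast Module.finrank_pos (R := ℚ) (M := K)
      exact one_le_pow₀ this
    nlinarith [abs_nonneg ((NumberField.discr K : ℝ))]
  have hh : (Fintype.card (ClassGroup (𝓞 K)) : ℝ) ≤ Q ^ a := by
    have h1 := ThornerZaman.classNumber_le_condQn_pow (K := K) hK
    rw [show (Fintype.card (ClassGroup (𝓞 K)) : ℝ) = (NumberField.classNumber K : ℝ) from rfl]
    refine h1.trans ?_
    rw [← hQ, ← Real.rpow_natCast]
    exact Real.rpow_le_rpow_of_exponent_le hQ1 (by push_cast; linarith)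
  have hκ' : (Q ^ a * (T + 2))⁻¹ ≤ NumberField.dedekindZeta_residue K := by
    refine le_trans ?_ hκ
    rw [Real.rpow_neg (by linarith)]
    refine inv_anti₀ (Real.rpow_pos_of_pos (by linarith) _) ?_
    exact (Real.rpow_le_rpow_of_exponent_le hQ1 haA).trans hP_ge
  refine ⟨by nlinarith, hd.trans (hQaQ.trans hP_ge), hh.trans hP_ge, hκ', by nlinarith⟩

open scoped Classical in
/-- **The density hypothesis for one character, in `Q`-form.** From the log-free zero-density
estimate for the family `{L₀(s,χ)}_{χ ≠ 1}` in degree `n` (the stub's hypothesis), for every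
real `A`: with `a = max A 4` and the SAME constants `c_D, C_D`, for every `K` of degree `n > 1` with
`κ_K ≥ Q^{−A}`, every `χ ≠ 1`, `T ≥ 1`, every finite set `u` of zeros of `L₀(·,χ)` with
`1/4 ≤ β < 1`, `|γ| ≤ T`, and every `α ≤ 1`:
`Σ_{ρ ∈ u, β ≥ α} m(ρ) ≤ C_D e^{c_D(a log Q + log(T+4))(1−α)}`. -/
theorem density_oneChar
    (hD : ∀ n : ℕ, ∃ c_D C_D : ℝ, 0 < c_D ∧ 0 < C_D ∧
      ∀ (K : Type) [Field K] [NumberField K], Module.finrank ℚ K = n →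
        (∀ χ : ClassGroup (𝓞 K) →* ℂˣ, χ ≠ 1 → ∀ ρ : ℂ,
          Literature.NumberTheory.LFunctions.NumberField.classGroupLFunction₀ K χ ρ = 0 → ρ.re < 1) →
        ∀ P : ℝ, 2 ≤ P → ((NumberField.discr K).natAbs : ℝ) ≤ P →
          (Fintype.card (ClassGroup (𝓞 K)) : ℝ) ≤ P → P⁻¹ ≤ NumberField.dedekindZeta_residue K →
        ∀ Z : (ClassGroup (𝓞 K) →* ℂˣ) → Finset ℂ,
          (∀ χ : ClassGroup (𝓞 K) →* ℂˣ, χ ≠ 1 → ∀ ρ ∈ Z χ,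
              Literature.NumberTheory.LFunctions.NumberField.classGroupLFunction₀ K χ ρ = 0 ∧
                1 / 4 ≤ ρ.re ∧ ρ.re < 1 ∧ |ρ.im| ≤ P) →
          ∀ α : ℝ, 0 ≤ α → α ≤ 1 →
            ∑ ψ : AddChar (Additive (ClassGroup (𝓞 K))) ℂ with ψ ≠ 0,
              ∑ ρ ∈ Z (Literature.NumberTheory.LFunctions.AbelianDensity.toMulHom ψ).toHomUnits with α ≤ ρ.re,
                (Literature.NumberTheory.LFunctions.LogFreeLocal.zeroOrder
                  (Literature.NumberTheory.LFunctions.NumberField.classGroupLFunction₀ K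
                    (Literature.NumberTheory.LFunctions.AbelianDensity.toMulHom ψ).toHomUnits) ρ : ℝ)
                  ≤ C_D * P ^ (c_D * (1 - α)))
    (n : ℕ) (hn : 1 < n) (A : ℝ) :
    ∃ c_D C_D : ℝ, 0 < c_D ∧ 0 < C_D ∧
    ∀ (K : Type) [Field K] [NumberField K], Module.finrank ℚ K = n →
      ThornerZaman.condQn K ^ (-A) ≤ NumberField.dedekindZeta_residue K →
      ∀ χ : ClassGroup (𝓞 K) →* ℂˣ, χ ≠ 1 →
      ∀ T : ℝ, 1 ≤ T → ∀ u : Finset ℂ,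
        (∀ ρ ∈ u, classGroupLFunction₀ K χ ρ = 0 ∧ 1 / 4 ≤ ρ.re ∧ ρ.re < 1 ∧ |ρ.im| ≤ T) →
        ∀ α : ℝ, α ≤ 1 →
          ∑ ρ ∈ u with α ≤ ρ.re, (analyticOrderNatAt (classGroupLFunction₀ K χ) ρ : ℝ) ≤
            C_D * Real.exp (c_D * (max A 4 * Real.log (ThornerZaman.condQn K) + Real.log (T + 4))) ^ (1 - α) := by
  obtain ⟨c_D, C_D, hc, hC, hdens⟩ := hD n
  refine ⟨c_D, C_D, hc, hC, fun K _ _ hKn hκ χ hχ T hT u hu α hα1 ↦ ?_⟩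
  have hK : 1 < Module.finrank ℚ K := by rw [hKn]; exact hn
  set a : ℝ := max A 4 with ha
  set Q : ℝ := ThornerZaman.condQn K with hQ
  have hQ12 : (12 : ℝ) ≤ Q := ThornerZaman.twelve_le_condQn (K := K) hK
  have hQ1 : (1 : ℝ) ≤ Q := by linarith
  set P : ℝ := Q ^ a * (T + 2) with hP
  obtain ⟨hP2, hdP, hhP, hκP, hTP⟩ :=
    sizeParam_admissible K hK (le_max_left _ _) (le_max_right _ _) hT hκ
  -- clamp `α` at `0`
  set α' : ℝ := max α 0 with hα'
  have hα'0 : 0 ≤ α' := le_max_right _ _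
  have hα'1 : α' ≤ 1 := max_le hα1 zero_le_one
  have hfilter : u.filter (fun ρ ↦ α ≤ ρ.re) = u.filter (fun ρ ↦ α' ≤ ρ.re) := by
    refine Finset.filter_congr fun ρ hρ ↦ ?_
    have := (hu ρ hρ).2.1
    rw [hα', max_le_iff]
    exact ⟨fun h ↦ ⟨h, by linarith⟩, fun h ↦ h.1⟩
  rw [hfilter]
  -- the zero sets: `u` at `χ`, empty elsewhere
  set Z : (ClassGroup (𝓞 K) →* ℂˣ) → Finset ℂ := fun χ' ↦ if χ' = χ then u else ∅ with hZ
  have hline : ∀ χ' : ClassGroup (𝓞 K) →* ℂˣ, χ' ≠ 1 → ∀ ρ : ℂ, classGroupLFunction₀ K χ' ρ = 0 → ρ.re < 1 := by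
    intro χ' hχ' ρ h0
    by_contra h1; rw [not_lt] at h1
    exact classGroupLFunction₀_ne_zero_of_one_le_re hχ' h1 h0
  have hZok : ∀ χ' : ClassGroup (𝓞 K) →* ℂˣ, χ' ≠ 1 → ∀ ρ ∈ Z χ',
      classGroupLFunction₀ K χ' ρ = 0 ∧ 1 / 4 ≤ ρ.re ∧ ρ.re < 1 ∧ |ρ.im| ≤ P := by
    intro χ' _ ρ hρ
    rw [hZ] at hρ; dsimp only at hρ
    by_cases hc' : χ' = χ
    · rw [if_pos hc'] at hρ
      subst hc'
      obtain ⟨h0, h14, h1, hT'⟩ := hu ρ hρ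
      exact ⟨h0, h14, h1, hT'.trans hTP⟩
    · rw [if_neg hc'] at hρ; exact absurd hρ (Finset.notMem_empty _)
  have key := hdens K hKn hline P hP2 hdP hhP hκP Z hZok α' hα'0 hα'1
  -- the character `ψ₀` with `χ_{ψ₀} = χ`
  obtain ⟨ψ₀, hψ₀⟩ := exists_toHomUnits_toMulHom_eq χ
  have hψ₀0 : ψ₀ ≠ 0 := by
    rintro rfl
    rw [toHomUnits_toMulHom_zero] at hψ₀
    exact hχ hψ₀.symm
  have hsingle : ∑ ρ ∈ u with α' ≤ ρ.re, (analyticOrderNatAt (classGroupLFunction₀ K χ) ρ : ℝ) ≤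
      ∑ ψ : AddChar (Additive (ClassGroup (𝓞 K))) ℂ with ψ ≠ 0,
        ∑ ρ ∈ Z (toMulHom ψ).toHomUnits with α' ≤ ρ.re,
          (zeroOrder (classGroupLFunction₀ K (toMulHom ψ).toHomUnits) ρ : ℝ) := by
    have hmem : ψ₀ ∈ Finset.univ.filter (fun ψ : AddChar (Additive (ClassGroup (𝓞 K))) ℂ ↦ ψ ≠ 0) := by
      rw [Finset.mem_filter]; exact ⟨Finset.mem_univ _, hψ₀0⟩
    refine le_trans (le_of_eq ?_) (Finset.single_le_sum (fun ψ _ ↦ Finset.sum_nonneg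
      fun ρ _ ↦ Nat.cast_nonneg _) hmem)
    rw [hψ₀, hZ]; dsimp only; rw [if_pos rfl]; rfl
  refine hsingle.trans (key.trans ?_)
  -- `P^{c_D(1-α')} ≤ exp(c_D(a log Q + log(T+4)))^{1-α}`
  have hP1 : (1 : ℝ) ≤ P := by linarith
  have hQa0 : 0 < Q ^ a := Real.rpow_pos_of_pos (by linarith) _
  have hPexp : P ≤ Real.exp (a * Real.log Q + Real.log (T + 4)) := by
    rw [Real.exp_add, Real.exp_log (by linarith), show a * Real.log Q = Real.log (Q ^ a) by
      rw [Real.log_rpow (by linarith)], Real.exp_log hQa0, hP]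
    nlinarith
  set B : ℝ := Real.exp (c_D * (a * Real.log Q + Real.log (T + 4))) with hBdef
  have h1α : 0 ≤ 1 - α' := by linarith
  have hαα : 1 - α' ≤ 1 - α := by rw [hα']; exact sub_le_sub_left (le_max_left _ _) _
  have hB1 : 1 ≤ B := Real.one_le_exp (by
    have : 0 ≤ Real.log Q := Real.log_nonneg hQ1
    have : 0 ≤ Real.log (T + 4) := Real.log_nonneg (by linarith)
    have : 0 ≤ a := le_trans (by norm_num) (le_max_right A 4)
    positivity)
  have hpow : P ^ (c_D * (1 - α')) ≤ B ^ (1 - α) := by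
    calc P ^ (c_D * (1 - α')) = (P ^ c_D) ^ (1 - α') := by rw [Real.rpow_mul (by linarith)]
      _ ≤ (Real.exp (a * Real.log Q + Real.log (T + 4)) ^ c_D) ^ (1 - α') :=
          Real.rpow_le_rpow (by positivity) (Real.rpow_le_rpow (by linarith) hPexp hc.le) h1α
      _ = B ^ (1 - α') := by rw [hBdef, ← Real.exp_mul]; ring_nf
      _ ≤ B ^ (1 - α) := Real.rpow_le_rpow_of_exponent_le hB1 hαα
  exact mul_le_mul_of_nonneg_left hpow hC.le

/-- Closed form of `density_oneChar`: the registered sub-goal of the stub `stub_perCharacterDeficit_of_density`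
proved by this file. -/
theorem perCharacterDeficit_density : ∀ (hD : ∀ n : ℕ, ∃ c_D C_D : ℝ, 0 < c_D ∧ 0 < C_D ∧
      ∀ (K : Type) [Field K] [NumberField K], Module.finrank ℚ K = n →
        (∀ χ : ClassGroup (𝓞 K) →* ℂˣ, χ ≠ 1 → ∀ ρ : ℂ,
          Literature.NumberTheory.LFunctions.NumberField.classGroupLFunction₀ K χ ρ = 0 → ρ.re < 1) →
        ∀ P : ℝ, 2 ≤ P → ((NumberField.discr K).natAbs : ℝ) ≤ P →
          (Fintype.card (ClassGroup (𝓞 K)) : ℝ) ≤ P → P⁻¹ ≤ NumberField.dedekindZeta_residue K →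
        ∀ Z : (ClassGroup (𝓞 K) →* ℂˣ) → Finset ℂ,
          (∀ χ : ClassGroup (𝓞 K) →* ℂˣ, χ ≠ 1 → ∀ ρ ∈ Z χ,
              Literature.NumberTheory.LFunctions.NumberField.classGroupLFunction₀ K χ ρ = 0 ∧
                1 / 4 ≤ ρ.re ∧ ρ.re < 1 ∧ |ρ.im| ≤ P) →
          ∀ α : ℝ, 0 ≤ α → α ≤ 1 →
            ∑ ψ : AddChar (Additive (ClassGroup (𝓞 K))) ℂ with ψ ≠ 0,
              ∑ ρ ∈ Z (Literature.NumberTheory.LFunctions.AbelianDensity.toMulHom ψ).toHomUnits with α ≤ ρ.re,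
                (Literature.NumberTheory.LFunctions.LogFreeLocal.zeroOrder
                  (Literature.NumberTheory.LFunctions.NumberField.classGroupLFunction₀ K
                    (Literature.NumberTheory.LFunctions.AbelianDensity.toMulHom ψ).toHomUnits) ρ : ℝ)
                  ≤ C_D * P ^ (c_D * (1 - α)))
    (n : ℕ) (hn : 1 < n) (A : ℝ),
    ∃ c_D C_D : ℝ, 0 < c_D ∧ 0 < C_D ∧
    ∀ (K : Type) [Field K] [NumberField K], Module.finrank ℚ K = n →
      ThornerZaman.condQn K ^ (-A) ≤ NumberField.dedekindZeta_residue K →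
      ∀ χ : ClassGroup (𝓞 K) →* ℂˣ, χ ≠ 1 →
      ∀ T : ℝ, 1 ≤ T → ∀ u : Finset ℂ,
        (∀ ρ ∈ u, classGroupLFunction₀ K χ ρ = 0 ∧ 1 / 4 ≤ ρ.re ∧ ρ.re < 1 ∧ |ρ.im| ≤ T) →
        ∀ α : ℝ, α ≤ 1 →
          ∑ ρ ∈ u with α ≤ ρ.re, (analyticOrderNatAt (classGroupLFunction₀ K χ) ρ : ℝ) ≤
            C_D * Real.exp (c_D * (max A 4 * Real.log (ThornerZaman.condQn K) + Real.log (T + 4))) ^ (1 - α) :=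
  @density_oneChar

end Summit.QuantumAdvantage.QuantumAdvantage.Theorems.DegreeOnePrimesEscape

end
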